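import Literature.NumberTheory.GaloisCohomology.BlochKatoForms
import HarnessLib

/-!
# Bloch–Kato 1986, Lemma (4.2), for fields: `Ωⁿ_K ≅ (K ⊗ (Kˣ)^{⊗ n})/J` as `K`-modules

Sequel to `GaloisCohomology/BlochKatoForms` (the presentation module `BlochKatoForms K n` and the hard
direction `BlochKatoForms.ofForms : ⋀ⁿ_K Ω[K⁄ℤ] → BlochKatoForms K n`).  Here the easy direction and the
isomorphism:

* `BlochKatoForms.toForms K n : BlochKatoForms K n →ₗ[K] ⋀[K]^n (Ω[K⁄ℤ])`, `e(v) ↦ dlog v₀ ∧ ⋯ ∧ dlog v_{n-1}`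
  (`0` if a slot vanishes) — Bloch–Kato's `δ`, well defined because the relations (Z), (M), (A), (Q) hold on
  forms (`dlogForm_update_mul`, `dlogForm_eq_zero_of_apply_eq`, and for (4.2.2):
  `y • dlog(…, y, …) = (⋯ ∧ dy ∧ ⋯)` is additive in `y`);
* `BlochKatoForms.equivForms K n : BlochKatoForms K n ≃ₗ[K] ⋀[K]^n (Ω[K⁄ℤ])` — **Lemma (4.2) for a field**:
  `δ` is an isomorphism with inverse `ofForms` (`ofForms ∘ δ = id` on generators by `ofForms_dlogForm`;
  `δ ∘ ofForms = id` on the spanning set `da₁ ∧ ⋯ ∧ daₙ` of `Ωⁿ_K`).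

Printed statement [cite: BlochKato1986, Lemma (4.2), p. 122]: for a ring `R` additively generated by its
units, `δ : R ⊗ (R^*)^{⊗ r} → Ω^r_R`, `x ⊗ y₁ ⊗ ⋯ ⊗ y_r ↦ x dy₁/y₁ ∧ ⋯ ∧ dy_r/y_r`, is surjective with kernel
generated by (4.2.1) and (4.2.2) ("Straightforward and left to the reader"); this file is the case of a
field (where every non-zero element is a unit, so the tensor product modulo (4.2.1) is the free module on
tuples modulo (Z), (M), (A)).  Everything is proved; no named fact.

## References

* S. Bloch, K. Kato, *p-adic étale cohomology*, Publ. Math. IHÉS 63 (1986), 107–152, Lemma (4.2),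
  p. 122. [BlochKato1986]
-/

noncomputable section

open KaehlerDifferential (D)
open Function (update)

namespace Literature.NumberTheory.GaloisCohomology

universe u

variable (K : Type u) [Field K] (n : ℕ)

namespace BlochKatoForms

variable {n}

open scoped Classical in
/-- The logarithmic form of a tuple `v : Fin n → K`: `dlog v₀ ∧ ⋯ ∧ dlog v_{n-1}` if all `v i ≠ 0`, else `0`
(Bloch–Kato's `δ` on a generator). [cite: BlochKato1986, Lemma (4.2)] -/
def tupleForm (v : Fin n → K) : ⋀[K]^n (Ω[K⁄ℤ]) :=
  if h : ∀ i, v i ≠ 0 then dlogForm K (fun i => Units.mk0 (v i) (h i)) else 0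

/-- `tupleForm` of a tuple of units is `dlogForm`. [folklore] -/
theorem tupleForm_units (b : Fin n → Kˣ) : tupleForm K (fun i => (b i : K)) = dlogForm K b := by
  rw [tupleForm, dif_pos (fun i => (b i).ne_zero)]
  congr 1
  funext i
  exact Units.mk0_val _ _

/-- `tupleForm` vanishes on a tuple with a zero slot. [folklore] -/
theorem tupleForm_eq_zero_of_apply_eq_zero (v : Fin n → K) {i : Fin n} (hi : v i = 0) : tupleForm K v = 0 := by
  rw [tupleForm, dif_neg]
  push Not
  exact ⟨i, hi⟩

/-- `tupleForm (update v i y) = dlogForm (update w i y)` when `w` is the unit tuple agreeing with `v` off `i`.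
[folklore] -/
theorem tupleForm_update (v : Fin n → K) (i : Fin n) (w : Fin n → Kˣ)
    (hw : ∀ j, j ≠ i → (w j : K) = v j) (y : Kˣ) :
    tupleForm K (update v i y) = dlogForm K (update w i y) := by
  have hv : update v i (y : K) = fun j => ((update w i y j : Kˣ) : K) := by
    funext j
    by_cases hj : j = i
    · subst hj; simp
    · simp [Function.update_of_ne hj, hw j hj]
  rw [hv, tupleForm_units]

/-- Off the slot `i`, a tuple with non-zero entries is a tuple of units. [folklore] -/
private theorem exists_units_of_ne' (v : Fin n → K) (i : Fin n) (H : ∀ j, j ≠ i → v j ≠ 0) :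
    ∃ w : Fin n → Kˣ, ∀ j, j ≠ i → (w j : K) = v j :=
  ⟨fun j => if h : j = i then 1 else Units.mk0 (v j) (H j h), fun j hj => by simp [hj]⟩

/-- If some slot `j ≠ i` of `v` vanishes, `tupleForm (update v i y) = 0`. [folklore] -/
theorem tupleForm_update_eq_zero (v : Fin n → K) (i : Fin n) (H : ¬ ∀ j, j ≠ i → v j ≠ 0) (y : K) :
    tupleForm K (update v i y) = 0 := by
  push Not at H
  obtain ⟨j, hj, hvj⟩ := H
  exact tupleForm_eq_zero_of_apply_eq_zero K _ (i := j) (by rw [Function.update_of_ne hj, hvj])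

/-- The key identity for (4.2.2) on forms: `y • dlog(…, y, …) = (⋯ ∧ dy ∧ ⋯)`, for every `y`
(both sides vanish at `y = 0`). [cite: BlochKato1986, Lemma (4.2), (4.2.2)] -/
theorem smul_tupleForm_update (v : Fin n → K) (i : Fin n) (w : Fin n → Kˣ)
    (hw : ∀ j, j ≠ i → (w j : K) = v j) (y : K) :
    y • tupleForm K (update v i y) =
      exteriorPower.ιMulti K n (update (fun j => unitDlog K (w j)) i (D ℤ K y)) := by
  by_cases hy : y = 0
  · rw [hy, zero_smul, map_zero]
    exact ((exteriorPower.ιMulti K n).map_coord_zero i (Function.update_self ..)).symm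
  have h1 : tupleForm K (update v i y) = dlogForm K (update w i (Units.mk0 y hy)) :=
    tupleForm_update K v i w hw (Units.mk0 y hy)
  have hcomp : (fun j => unitDlog K (update w i (Units.mk0 y hy) j)) =
      update (fun j => unitDlog K (w j)) i (unitDlog K (Units.mk0 y hy)) := by
    funext j
    by_cases hj : j = i
    · subst hj; simp
    · simp [Function.update_of_ne hj]
  have hy' : y • unitDlog K (Units.mk0 y hy) = D ℤ K y := by
    rw [unitDlog, smul_smul, Units.val_inv_eq_inv_val, Units.val_mk0, mul_inv_cancel₀ hy, one_smul]
  rw [h1, dlogForm, hcomp, ← AlternatingMap.map_update_smul, hy']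

variable (n)

/-- **Bloch–Kato's `δ`**: the `K`-linear map `BlochKatoForms K n → Ωⁿ_K`, `e(v) ↦ dlog v₀ ∧ ⋯ ∧ dlog v_{n-1}`
(well defined: the relations (Z), (M), (A), (Q) hold on forms). [cite: BlochKato1986, Lemma (4.2), p. 122] -/
def toForms : BlochKatoForms K n →ₗ[K] ⋀[K]^n (Ω[K⁄ℤ]) :=
  lift (tupleForm K)
    (fun v _ hv => tupleForm_eq_zero_of_apply_eq_zero K v hv)
    (fun v i c c' hc hc' => by
      by_cases H : ∀ j, j ≠ i → v j ≠ 0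
      · obtain ⟨w, hw⟩ := exists_units_of_ne' K v i H
        have h1 : tupleForm K (update v i (c * c')) = dlogForm K (update w i (Units.mk0 c hc * Units.mk0 c' hc')) :=
          tupleForm_update K v i w hw (Units.mk0 c hc * Units.mk0 c' hc')
        have h2 : tupleForm K (update v i c) = dlogForm K (update w i (Units.mk0 c hc)) :=
          tupleForm_update K v i w hw (Units.mk0 c hc)
        have h3 : tupleForm K (update v i c') = dlogForm K (update w i (Units.mk0 c' hc')) :=
          tupleForm_update K v i w hw (Units.mk0 c' hc')
        rw [h1, h2, h3, dlogForm_update_mul]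
      · simp only [tupleForm_update_eq_zero K v i H, add_zero])
    (fun v i j hij hv => by
      unfold tupleForm
      split_ifs with h
      · exact dlogForm_eq_zero_of_apply_eq K _ hij (Units.ext hv)
      · rfl)
    (fun v i c c' => by
      by_cases H : ∀ j, j ≠ i → v j ≠ 0
      · obtain ⟨w, hw⟩ := exists_units_of_ne' K v i H
        rw [smul_tupleForm_update K v i w hw, smul_tupleForm_update K v i w hw,
          smul_tupleForm_update K v i w hw, map_add, AlternatingMap.map_update_add]
      · simp only [tupleForm_update_eq_zero K v i H, smul_zero, add_zero])

variable {n}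

/-- `δ (e v) = tupleForm v`. [folklore] -/
@[simp] theorem toForms_gen (v : Fin n → K) : toForms K n (gen K v) = tupleForm K v :=
  lift_gen _ _ _ _ _ v

/-- `δ (e(b)) = dlog b₀ ∧ ⋯ ∧ dlog b_{n-1}` for a tuple of units `b`. [cite: BlochKato1986, Lemma (4.2)] -/
theorem toForms_gen_units (b : Fin n → Kˣ) : toForms K n (gen K fun i => (b i : K)) = dlogForm K b := by
  rw [toForms_gen, tupleForm_units]

/-- `ofForms ∘ δ = id`. [cite: BlochKato1986, Lemma (4.2)] -/
theorem ofForms_comp_toForms : (ofForms K n).comp (toForms K n) = LinearMap.id := by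
  refine hom_ext K fun v => ?_
  rw [LinearMap.comp_apply, LinearMap.id_apply, toForms_gen]
  by_cases h : ∀ i, v i ≠ 0
  · have hv : v = fun i => ((Units.mk0 (v i) (h i) : Kˣ) : K) := funext fun _ => rfl
    conv_lhs => rw [hv, tupleForm_units]
    rw [ofForms_dlogForm, ← hv]
  · push Not at h
    obtain ⟨i, hi⟩ := h
    rw [tupleForm_eq_zero_of_apply_eq_zero K v hi, map_zero, gen_eq_zero_of_apply_eq_zero K v i hi]

/-- `da₁ ∧ ⋯ ∧ daₙ = (∏ aᵢ) • tupleForm a`. [folklore] -/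
theorem ιMulti_D_eq_prod_smul_tupleForm (a : Fin n → K) :
    exteriorPower.ιMulti K n (fun i => D ℤ K (a i)) = (∏ i, a i) • tupleForm K a := by
  by_cases h : ∀ i, a i ≠ 0
  · rw [tupleForm, dif_pos h, dlogForm, ← AlternatingMap.map_smul_univ]
    congr 1
    funext i
    rw [unitDlog, smul_smul, Units.val_inv_eq_inv_val, Units.val_mk0, mul_inv_cancel₀ (h i), one_smul]
  · push Not at h
    obtain ⟨i, hi⟩ := h
    rw [tupleForm_eq_zero_of_apply_eq_zero K a hi, smul_zero]
    exact (exteriorPower.ιMulti K n).map_coord_zero i (by simp [hi])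

/-- `δ ∘ ofForms = id` (checked on the spanning set `da₁ ∧ ⋯ ∧ daₙ` of `Ωⁿ_K`). [cite: BlochKato1986, Lemma (4.2)] -/
theorem toForms_comp_ofForms : (toForms K n).comp (ofForms K n) = LinearMap.id := by
  refine LinearMap.ext_on (exteriorPower.ιMulti_span_of_span K n (Ω[K⁄ℤ])
    (KaehlerDifferential.span_range_derivation (R := ℤ) (S := K))) ?_
  rintro _ ⟨x, hxs, rfl⟩
  -- each `x i ∈ Set.range (D ℤ K)` is `D (a i)`
  choose a ha using fun i => hxs (Set.mem_range_self i)
  have hx : x = fun i => D ℤ K (a i) := funext fun i => (ha i).symm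
  simp only [LinearMap.comp_apply, LinearMap.id_apply, hx]
  rw [ofForms_ιMulti_D, map_smul, toForms_gen, ιMulti_D_eq_prod_smul_tupleForm]

/-- **Bloch–Kato 1986, Lemma (4.2), for a field**: `δ : BlochKatoForms K n ≃ₗ[K] Ωⁿ_K = ⋀ⁿ_K Ω[K⁄ℤ]`,
`e(v) ↦ dlog v₀ ∧ ⋯ ∧ dlog v_{n-1}` — the differential `n`-forms of a field are presented by the symbols
`x · dy₁/y₁ ∧ ⋯ ∧ dyₙ/yₙ` modulo multiplicativity, vanishing on a zero or repeated slot, and (4.2.2); the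
inverse is `ofForms`. [cite: BlochKato1986, Lemma (4.2), p. 122] -/
def equivForms : BlochKatoForms K n ≃ₗ[K] ⋀[K]^n (Ω[K⁄ℤ]) :=
  LinearEquiv.ofLinear (toForms K n) (ofForms K n) (toForms_comp_ofForms K) (ofForms_comp_toForms K)

/-- `equivForms (e v) = tupleForm v`. [folklore] -/
@[simp] theorem equivForms_gen (v : Fin n → K) : equivForms K (n := n) (gen K v) = tupleForm K v :=
  toForms_gen K v

/-- `equivForms.symm (dlog b₀ ∧ ⋯ ∧ dlog b_{n-1}) = e(b)`. [folklore] -/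
theorem equivForms_symm_dlogForm (b : Fin n → Kˣ) :
    (equivForms K (n := n)).symm (dlogForm K b) = gen K fun i => (b i : K) :=
  ofForms_dlogForm K n b

end BlochKatoForms

end Literature.NumberTheory.GaloisCohomology

end
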